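import Summits.SmoothPoincare4.SmoothPoincare4.Theses.EntropyRung
import Summits.SmoothPoincare4.SmoothPoincare4.Theorems.EntropyRungSubcylindricalExistenceCapFactor
import Summits.SmoothPoincare4.SmoothPoincare4.Theorems.EntropyRungSubcylindricalExistenceEntropyLocalisation
import Literature.Geometry.Lorentzian.DalembertianCompose
import Literature.Geometry.Lorentzian.ChartLaplacian
import Literature.Geometry.Lorentzian.VolumeChartFormula
import Literature.Geometry.Riemannian.PerelmanEntropyCutoff
import Mathlib.Analysis.Calculus.Gradient.Basic
import Mathlib.Analysis.InnerProductSpace.Calculus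
import Mathlib.Analysis.Calculus.Deriv.Inv
import Mathlib.Analysis.Calculus.Deriv.Shift
import HarnessLib

/-!
# Helpers for stub `stub_sphereSideClause` (S2, line `green-blowup-conformal-entropy`, crux
`EntropyRung.SubcylindricalExistence`, item stmt-SmoothPoincare4-10871): the round cap

Pointwise and chart-level lemmas for the cap side of the flat-gauge conformal gluing (companion
file `EntropyRungSubcylindricalExistenceSphereSideClause.lean`): the one-variable algebra of the
Möbius profile `θ_K(s) = 4K − 16K²/(4K+s) = 4Ks/(4K+s)` and the cap inequality `cap_algebra`;
the weight identity of the substitution `τ ↦ τ/(aK)`, `u_l ↦ Ψ = 4Ka/(4Km + a)` (`l² = 16K/a`);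
`‖∇(a/‖y−y₀‖²)‖² = 4a²/‖y−y₀‖⁶`; the chart extension `𝟙_{target}·(v ∘ φ⁻¹)` of a smooth `v`
supported in a chart ball is smooth with compact support on `ℝ⁴` (`chartExt_*`);
`ψ ∘ φ⁻¹ = 4Ka/(4K‖y−y₀‖²+a)` on the flat ball (`psi_chart`); and the registered sub-goal
`sphereSideCurvBound` (= `curv_bound`): the curvature weight bound
`ψ⁻³ (R_g ψ − 6Δ_g ψ) ≥ 12/(aK)` on the punctured flat ball, from the chain rule
`dalembertian_real_comp`, the Green equation, concavity of `θ_K`, `R_g ≥ 0`, and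
`|∇G|²_g = 4a²/‖y−y₀‖⁶` (by-text flat-chart gradient identity S0). References: Schoen 1984 (flat
conformal gauge); Lee–Parker 1987, §3; O'Neill 1983, Ch. 3 (chain rule for `Δ_g`). [folklore]
-/

noncomputable section

-- the registered namespace `Summit.SmoothPoincare4.SmoothPoincare4.Theorems` repeats a component
set_option linter.dupNamespace false

open scoped Manifold ContDiff Topology RealInnerProductSpace
open Set Filter MeasureTheory
open Literature.Geometry.Lorentzian Literature.Geometry.Riemannian

namespace Summit.SmoothPoincare4.SmoothPoincare4.Theorems

namespace SphereSideClause

/-! ### One-variable algebra -/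

/-- `x ^ (-4/2) = (x²)⁻¹` for `x > 0`. [folklore] -/
theorem rpow_neg_four_half {x : ℝ} (hx : 0 < x) : x ^ (-(4 : ℝ) / 2) = (x ^ 2)⁻¹ := by
  rw [show (-(4 : ℝ) / 2) = -(2 : ℝ) by norm_num, Real.rpow_neg hx.le, Real.rpow_two]

/-- The Möbius profile `θ_K(s) = 4K − 16K²/(4K+s)` equals `4Ks/(4K+s)`. [folklore] -/
theorem theta_eq {K s : ℝ} (h : 4 * K + s ≠ 0) :
    4 * K - 16 * K ^ 2 * (4 * K + s)⁻¹ = 4 * K * s / (4 * K + s) := by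
  field_simp
  ring

/-- `θ_K' (s) = 16K²/(4K+s)²` (as functions, junk values included). [folklore] -/
theorem deriv_theta (K : ℝ) :
    deriv (fun s : ℝ ↦ 4 * K - 16 * K ^ 2 * (4 * K + s)⁻¹) =
      fun s ↦ 16 * K ^ 2 * ((4 * K + s) ^ 2)⁻¹ := by
  funext s
  rw [deriv_const_sub, deriv_const_mul_field, deriv_comp_const_add (f := fun x : ℝ ↦ x⁻¹),
    deriv_inv]
  ring

/-- `θ_K'' (s) = −32K²/(4K+s)³` for `4K + s ≠ 0`. [folklore] -/
theorem deriv_deriv_theta {K s : ℝ} (h : 4 * K + s ≠ 0) :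
    deriv (deriv (fun s : ℝ ↦ 4 * K - 16 * K ^ 2 * (4 * K + s)⁻¹)) s =
      -(32 * K ^ 2) * ((4 * K + s) ^ 3)⁻¹ := by
  rw [deriv_theta]
  have h1 : HasDerivAt (fun x : ℝ ↦ (4 * K + x) ^ 2) (2 * (4 * K + s)) s := by
    simpa using ((hasDerivAt_id s).const_add (4 * K)).fun_pow 2
  have h2 := (h1.fun_inv (pow_ne_zero 2 h)).const_mul (16 * K ^ 2)
  rw [h2.deriv]
  have e : (((4 * K + s) ^ 2) ^ 2)⁻¹ = ((4 * K + s) ^ 3)⁻¹ * (4 * K + s)⁻¹ := by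
    rw [← mul_inv, show (4 * K + s) ^ 3 * (4 * K + s) = ((4 * K + s) ^ 2) ^ 2 by ring]
  rw [div_eq_mul_inv, e]
  have e2 : (4 * K + s) * (4 * K + s)⁻¹ = 1 := mul_inv_cancel₀ h
  linear_combination (-(32 * K ^ 2) * ((4 * K + s) ^ 3)⁻¹) * e2

/-- The Möbius profile is smooth away from `s = −4K`. [folklore] -/
theorem contDiffAt_theta {K s : ℝ} (h : 4 * K + s ≠ 0) (n : WithTop ℕ∞) :
    ContDiffAt ℝ n (fun s : ℝ ↦ 4 * K - 16 * K ^ 2 * (4 * K + s)⁻¹) s :=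
  contDiffAt_const.sub (contDiffAt_const.mul ((contDiffAt_const.add contDiffAt_id).inv h))

/-- The pointwise algebra of the round cap: with `G = a/n`, `|∇G|² = 4a²/n³`, `ψ = 4KG/(4K+G)`,
`θ' = 16K²/(4K+G)²`, `θ'' = −32K²/(4K+G)³` and `R ≥ 0`,
`ψ⁻³ (R ψ − 6(θ''|∇G|² + θ' · R G/6)) ≥ 12/(aK)` (equality for `R = 0`). [folklore] -/
theorem cap_algebra {K a n R : ℝ} (hK : 0 < K) (ha : 0 < a) (hn : 0 < n) (hR : 0 ≤ R) :
    12 / (a * K) ≤ ((4 * K * (a / n) / (4 * K + a / n)) ^ 3)⁻¹ *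
      (R * (4 * K * (a / n) / (4 * K + a / n)) -
        6 * (-(32 * K ^ 2) * ((4 * K + a / n) ^ 3)⁻¹ * (4 * a ^ 2 / n ^ 3) +
          16 * K ^ 2 * ((4 * K + a / n) ^ 2)⁻¹ * (R * (a / n) / 6))) := by
  have hs : 0 < a / n := div_pos ha hn
  set s := a / n with hs_def
  have hψ : 0 < 4 * K * s / (4 * K + s) := by positivity
  rw [← div_eq_inv_mul, le_div_iff₀ (by positivity)]
  have hQ : 4 * a ^ 2 / n ^ 3 = 4 * s ^ 3 / a := by
    rw [hs_def]
    field_simp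
  rw [hQ]
  have h4Ks : 0 < 4 * K + s := by positivity
  have key : 12 / (a * K) * (4 * K * s / (4 * K + s)) ^ 3 =
      -(6 * (-(32 * K ^ 2) * ((4 * K + s) ^ 3)⁻¹ * (4 * s ^ 3 / a))) := by
    field_simp
    ring
  have hRpart : 0 ≤ R * (4 * K * s / (4 * K + s)) -
      6 * (16 * K ^ 2 * ((4 * K + s) ^ 2)⁻¹ * (R * s / 6)) := by
    have : R * (4 * K * s / (4 * K + s)) - 6 * (16 * K ^ 2 * ((4 * K + s) ^ 2)⁻¹ * (R * s / 6))
        = R * (4 * K * s ^ 2 / (4 * K + s) ^ 2) := by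
      field_simp
      ring
    rw [this]
    positivity
  nlinarith [key, hRpart]

/-- The weight algebra of the substitution, full integrand: the S1 integrand at scale `τ/(aK)`
is the `ψ`-weighted integrand with the curvature weight frozen at `12/(aK)`. [folklore] -/
theorem weight_identity {K a τ m : ℝ} (hK : 0 < K) (ha : 0 < a) (hτ : 0 < τ) (hm : 0 ≤ m)
    {l : ℝ} (hl2 : l ^ 2 = 16 * K / a) (V2 Gn Lg : ℝ) :
    (τ / (a * K) * (12 * V2 + 4 * ((l * (4 / (l ^ 2 * m + 4)))⁻¹ ^ 2 * Gn)) - Lg - 4 * V2) *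
        ((4 * Real.pi * (τ / (a * K))) ^ (-(4 : ℝ) / 2) * (l * (4 / (l ^ 2 * m + 4))) ^ 4) =
      (τ * (12 / (a * K) * V2 + 4 * ((4 * K * a / (4 * K * m + a))⁻¹ ^ 2 * Gn)) - Lg - 4 * V2) *
        ((4 * Real.pi * τ) ^ (-(4 : ℝ) / 2) * (4 * K * a / (4 * K * m + a)) ^ 4) := by
  rw [rpow_neg_four_half (by positivity), rpow_neg_four_half (by positivity)]
  have e1 : (l * (4 / (l ^ 2 * m + 4))) ^ 4 = (l ^ 2) ^ 2 * (4 / (l ^ 2 * m + 4)) ^ 4 := by ring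
  have e2 : (l * (4 / (l ^ 2 * m + 4)))⁻¹ ^ 2 = (l ^ 2)⁻¹ * ((4 / (l ^ 2 * m + 4)))⁻¹ ^ 2 := by
    rw [mul_inv, mul_pow, inv_pow]
  rw [e1, e2, hl2]
  have hpi := Real.pi_pos
  field_simp
  ring

/-! ### Euclidean lemmas -/

section Euclidean

variable {F : Type*} [NormedAddCommGroup F] [InnerProductSpace ℝ F] [CompleteSpace F]

/-- The gradient commutes with translations. [folklore] -/
theorem gradient_comp_add_right (V : F → ℝ) (y₀ z : F) :
    gradient (fun z ↦ V (z + y₀)) z = gradient V (z + y₀) := by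
  simp only [gradient, fderiv_comp_add_right]

/-- `‖∇(a/‖y − y₀‖²)‖² = 4a²/‖y − y₀‖⁶` off `y₀`. [folklore] -/
theorem norm_gradient_div_norm_sq (a : ℝ) {y y₀ : F} (hy : y ≠ y₀) :
    ‖gradient (fun z : F ↦ a / ‖z - y₀‖ ^ 2) y‖ ^ 2 = 4 * a ^ 2 / (‖y - y₀‖ ^ 2) ^ 3 := by
  have hn0 : ‖y - y₀‖ ^ 2 ≠ 0 := by
    have : y - y₀ ≠ 0 := sub_ne_zero.2 hy
    positivity
  have h1 : HasFDerivAt (fun z : F ↦ ‖z - y₀‖ ^ 2)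
      (2 • (innerSL ℝ (y - y₀)).comp (ContinuousLinearMap.id ℝ F)) y :=
    (hasFDerivAt_sub_const y₀).norm_sq
  have h2 := ((hasDerivAt_inv hn0).comp_hasFDerivAt y h1).const_mul a
  have hfun : (fun z : F ↦ a / ‖z - y₀‖ ^ 2) =
      fun z ↦ a * ((fun t : ℝ ↦ t⁻¹) ∘ fun z : F ↦ ‖z - y₀‖ ^ 2) z := by
    funext z
    simp [div_eq_mul_inv]
  have hgrad : gradient (fun z : F ↦ a / ‖z - y₀‖ ^ 2) y =
      (a * (-((‖y - y₀‖ ^ 2) ^ 2)⁻¹ * 2)) • (y - y₀) := by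
    rw [hfun, gradient, h2.fderiv]
    have : a • (-((‖y - y₀‖ ^ 2) ^ 2)⁻¹) • ((2 : ℕ) • (innerSL ℝ (y - y₀)).comp
        (ContinuousLinearMap.id ℝ F)) =
        InnerProductSpace.toDual ℝ F ((a * (-((‖y - y₀‖ ^ 2) ^ 2)⁻¹ * 2)) • (y - y₀)) := by
      ext w
      simp [innerSL_apply_apply, InnerProductSpace.toDual_apply_apply]
      ring
    rw [this, LinearIsometryEquiv.symm_apply_apply]
  rw [hgrad, norm_smul, mul_pow, Real.norm_eq_abs, sq_abs]
  field_simp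
  ring

end Euclidean

/-! ### The chart extension of a function supported in a chart ball -/

section ChartExtension

variable {M : Type} [TopologicalSpace M] [ChartedSpace (EuclideanSpace ℝ (Fin 4)) M]

/-- The chart extension `𝟙_{target} · (v ∘ φ⁻¹)` is `v ∘ φ⁻¹` near points of the target. [folklore] -/
theorem chartExt_eventuallyEq (p : M) (v : M → ℝ) {y : EuclideanSpace ℝ (Fin 4)}
    (hy : y ∈ (extChartAt (𝓡 4) p).target) :
    (extChartAt (𝓡 4) p).target.indicator (v ∘ (extChartAt (𝓡 4) p).symm) =ᶠ[𝓝 y]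
      (v ∘ (extChartAt (𝓡 4) p).symm) := by
  filter_upwards [(isOpen_extChartAt_target p).mem_nhds hy] with z hz
  exact indicator_of_mem hz _

/-- The support of the chart extension lies in the chart image of `tsupport v`. [folklore] -/
theorem chartExt_support_subset (p : M) (v : M → ℝ) :
    Function.support ((extChartAt (𝓡 4) p).target.indicator (v ∘ (extChartAt (𝓡 4) p).symm)) ⊆
      extChartAt (𝓡 4) p '' tsupport v := by
  intro y hy
  rw [Function.mem_support] at hy
  have hyt : y ∈ (extChartAt (𝓡 4) p).target := by
    by_contra h
    exact hy (indicator_of_notMem h _)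
  rw [indicator_of_mem hyt] at hy
  exact ⟨(extChartAt (𝓡 4) p).symm y, subset_tsupport v hy, (extChartAt (𝓡 4) p).right_inv hyt⟩

/-- The chart image of `tsupport v ⊆ source` is compact. [folklore] -/
theorem isCompact_image_tsupport [CompactSpace M] (p : M) {v : M → ℝ}
    (hsub : tsupport v ⊆ (extChartAt (𝓡 4) p).source) :
    IsCompact (extChartAt (𝓡 4) p '' tsupport v) :=
  (isClosed_tsupport v).isCompact.image_of_continuousOn ((continuousOn_extChartAt p).mono hsub)

/-- Off the chart image of `tsupport v`, the chart extension vanishes locally. [folklore] -/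
theorem chartExt_eventuallyEq_zero [CompactSpace M] (p : M) {v : M → ℝ}
    (hsub : tsupport v ⊆ (extChartAt (𝓡 4) p).source) {y : EuclideanSpace ℝ (Fin 4)}
    (hy : y ∉ extChartAt (𝓡 4) p '' tsupport v) :
    (extChartAt (𝓡 4) p).target.indicator (v ∘ (extChartAt (𝓡 4) p).symm) =ᶠ[𝓝 y]
      fun _ ↦ 0 := by
  filter_upwards [(isCompact_image_tsupport p hsub).isClosed.isOpen_compl.mem_nhds hy] with z hz
  exact Function.notMem_support.1 fun h ↦ hz (chartExt_support_subset p v h)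

/-- The chart extension is smooth on all of `ℝ⁴`. [folklore] -/
theorem chartExt_contDiff [CompactSpace M] [IsManifold (𝓡 4) ∞ M] (p : M) {v : M → ℝ}
    (hv : ContMDiff (𝓡 4) 𝓘(ℝ, ℝ) ∞ v) (hsub : tsupport v ⊆ (extChartAt (𝓡 4) p).source) :
    ContDiff ℝ ∞ ((extChartAt (𝓡 4) p).target.indicator (v ∘ (extChartAt (𝓡 4) p).symm)) := by
  rw [contDiff_iff_contDiffAt]
  intro y
  by_cases hy : y ∈ (extChartAt (𝓡 4) p).target
  · have h1 : ContMDiffAt 𝓘(ℝ, EuclideanSpace ℝ (Fin 4)) 𝓘(ℝ, ℝ) ∞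
        (v ∘ (extChartAt (𝓡 4) p).symm) y :=
      ((hv.comp_contMDiffOn (contMDiffOn_extChartAt_symm p)) y hy).contMDiffAt
        ((isOpen_extChartAt_target p).mem_nhds hy)
    exact (contMDiffAt_iff_contDiffAt.1 h1).congr_of_eventuallyEq (chartExt_eventuallyEq p v hy)
  · have hy' : y ∉ extChartAt (𝓡 4) p '' tsupport v := fun ⟨x, hx, hxy⟩ ↦
      hy (hxy ▸ (extChartAt (𝓡 4) p).map_source (hsub hx))
    exact contDiffAt_const.congr_of_eventuallyEq (chartExt_eventuallyEq_zero p hsub hy')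

/-- The chart extension has compact support. [folklore] -/
theorem chartExt_hasCompactSupport [CompactSpace M] (p : M) {v : M → ℝ}
    (hsub : tsupport v ⊆ (extChartAt (𝓡 4) p).source) :
    HasCompactSupport ((extChartAt (𝓡 4) p).target.indicator (v ∘ (extChartAt (𝓡 4) p).symm)) :=
  HasCompactSupport.of_support_subset_isCompact (isCompact_image_tsupport p hsub)
    (chartExt_support_subset p v)

/-- Off the chart image of `tsupport v`, the extension and its gradient vanish. [folklore] -/
theorem chartExt_eq_zero [CompactSpace M] (p : M) {v : M → ℝ}
    (hsub : tsupport v ⊆ (extChartAt (𝓡 4) p).source) {y : EuclideanSpace ℝ (Fin 4)}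
    (hy : y ∉ extChartAt (𝓡 4) p '' tsupport v) :
    (extChartAt (𝓡 4) p).target.indicator (v ∘ (extChartAt (𝓡 4) p).symm) y = 0 ∧
      gradient ((extChartAt (𝓡 4) p).target.indicator (v ∘ (extChartAt (𝓡 4) p).symm)) y = 0 := by
  have h := chartExt_eventuallyEq_zero p hsub hy
  exact ⟨h.eq_of_nhds, by rw [h.gradient_eq]; exact gradient_fun_const y 0⟩

/-- In the chart, `ψ ∘ φ⁻¹ (y) = 4Ka/(4K‖y − y₀‖² + a)` on the closed flat ball. [folklore] -/
theorem psi_chart (p : M) {G ψ : M → ℝ} {a r K : ℝ} (ha : 0 < a)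
    (hball : Metric.closedBall (extChartAt (𝓡 4) p p) r ⊆ (extChartAt (𝓡 4) p).target)
    (hGchart : ∀ y ∈ Metric.closedBall (extChartAt (𝓡 4) p p) r, y ≠ extChartAt (𝓡 4) p p →
      G ((extChartAt (𝓡 4) p).symm y) = a / ‖y - extChartAt (𝓡 4) p p‖ ^ 2)
    (hψ : ∀ x, x ≠ p → ψ x = 4 * K * G x / (4 * K + G x)) (hψp : ψ p = 4 * K)
    {y : EuclideanSpace ℝ (Fin 4)} (hy : y ∈ Metric.closedBall (extChartAt (𝓡 4) p p) r) :
    ψ ((extChartAt (𝓡 4) p).symm y) =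
      4 * K * a / (4 * K * ‖y - extChartAt (𝓡 4) p p‖ ^ 2 + a) := by
  by_cases hy0 : y = extChartAt (𝓡 4) p p
  · rw [hy0, extChartAt_to_inv, hψp, sub_self, norm_zero, zero_pow two_ne_zero, mul_zero,
      zero_add, mul_div_assoc, div_self ha.ne', mul_one]
  · have hx : (extChartAt (𝓡 4) p).symm y ≠ p := by
      intro h
      apply hy0
      rw [← (extChartAt (𝓡 4) p).right_inv (hball hy), h]
    have hn : ‖y - extChartAt (𝓡 4) p p‖ ≠ 0 := norm_ne_zero_iff.2 (sub_ne_zero.2 hy0)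
    rw [hψ _ hx, hGchart y hy hy0]
    field_simp

end ChartExtension

/-! ### The curvature weight of the cap factor on the punctured flat ball -/

section Cap

variable {M : Type} [TopologicalSpace M] [T2Space M] [ChartedSpace (EuclideanSpace ℝ (Fin 4)) M]
  [IsManifold (𝓡 4) ∞ M]
  (g : PseudoRiemannianMetric (𝓡 4) ∞ (EuclideanSpace ℝ (Fin 4)) (TangentSpace (𝓡 4) : M → Type _))
  [g.HasLeviCivita]

/-- **`ψ⁻³ L_g ψ ≥ 12/(aK)` on the punctured flat ball**: off `p`, `ψ = θ ∘ G`, so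
`L_g ψ = R(θ(G) − Gθ'(G)) − 6θ''(G)|∇G|²` (chain rule, Green equation), `|∇G|² = 4a²/‖y − y₀‖⁶`
by the by-text flat-chart gradient identity `hS0`, and `cap_algebra`. [folklore] -/
theorem curv_bound {p : M}
    (hS0 : ∀ y : EuclideanSpace ℝ (Fin 4), y ∈ (extChartAt (𝓡 4) p).target →
      (∀ X W : EuclideanSpace ℝ (Fin 4), g.val ((extChartAt (𝓡 4) p).symm y)
          (mfderiv 𝓘(ℝ, EuclideanSpace ℝ (Fin 4)) (𝓡 4) (extChartAt (𝓡 4) p).symm y X)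
          (mfderiv 𝓘(ℝ, EuclideanSpace ℝ (Fin 4)) (𝓡 4) (extChartAt (𝓡 4) p).symm y W) =
            ⟪X, W⟫) →
      ∀ f : M → ℝ, MDifferentiableAt (𝓡 4) 𝓘(ℝ, ℝ) f ((extChartAt (𝓡 4) p).symm y) →
        g.gradSq f ((extChartAt (𝓡 4) p).symm y) =
          ‖gradient (f ∘ (extChartAt (𝓡 4) p).symm) y‖ ^ 2)
    (hR : ∀ x, 0 ≤ g.scalarCurvature x) {G : M → ℝ} (hGs : ContMDiffOn (𝓡 4) 𝓘(ℝ, ℝ) ∞ G {p}ᶜ)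
    (hGpos : ∀ x, x ≠ p → 0 < G x)
    (hGreen : ∀ x, x ≠ p → g.scalarCurvature x * G x - 6 * g.dalembertian G x = 0)
    {a r : ℝ} (ha : 0 < a)
    (hball : Metric.closedBall (extChartAt (𝓡 4) p p) r ⊆ (extChartAt (𝓡 4) p).target)
    (hflat : ∀ y ∈ Metric.closedBall (extChartAt (𝓡 4) p p) r, ∀ X W : EuclideanSpace ℝ (Fin 4),
      g.val ((extChartAt (𝓡 4) p).symm y)
        (mfderiv 𝓘(ℝ, EuclideanSpace ℝ (Fin 4)) (𝓡 4) (extChartAt (𝓡 4) p).symm y X)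
        (mfderiv 𝓘(ℝ, EuclideanSpace ℝ (Fin 4)) (𝓡 4) (extChartAt (𝓡 4) p).symm y W) = ⟪X, W⟫)
    (hGchart : ∀ y ∈ Metric.closedBall (extChartAt (𝓡 4) p p) r, y ≠ extChartAt (𝓡 4) p p →
      G ((extChartAt (𝓡 4) p).symm y) = a / ‖y - extChartAt (𝓡 4) p p‖ ^ 2)
    {K : ℝ} (hK : 0 < K) {ψ : M → ℝ} (hψ : ∀ x, x ≠ p → ψ x = 4 * K * G x / (4 * K + G x))
    {y : EuclideanSpace ℝ (Fin 4)} (hy : y ∈ Metric.ball (extChartAt (𝓡 4) p p) r)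
    (hy0 : y ≠ extChartAt (𝓡 4) p p) :
    12 / (a * K) ≤ (ψ ((extChartAt (𝓡 4) p).symm y) ^ 3)⁻¹ *
      (g.scalarCurvature ((extChartAt (𝓡 4) p).symm y) * ψ ((extChartAt (𝓡 4) p).symm y) -
        6 * g.dalembertian ψ ((extChartAt (𝓡 4) p).symm y)) := by
  set φ := extChartAt (𝓡 4) p with hφ
  have hyc : y ∈ Metric.closedBall (φ p) r := Metric.ball_subset_closedBall hy
  have hyt : y ∈ φ.target := hball hyc
  have hxp : φ.symm y ≠ p := by
    intro h
    apply hy0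
    rw [← φ.right_inv hyt, h]
  have hGx : ContMDiffAt (𝓡 4) 𝓘(ℝ, ℝ) ∞ G (φ.symm y) :=
    (hGs _ hxp).contMDiffAt (isOpen_compl_singleton.mem_nhds hxp)
  have hG2 : ContMDiffAt (𝓡 4) 𝓘(ℝ, ℝ) 2 G (φ.symm y) := hGx.of_le (WithTop.coe_le_coe.mpr le_top)
  have hGy : 0 < G (φ.symm y) := hGpos _ hxp
  have h4K : 4 * K + G (φ.symm y) ≠ 0 := by positivity
  have hev : ψ =ᶠ[𝓝 (φ.symm y)] ((fun s : ℝ ↦ 4 * K - 16 * K ^ 2 * (4 * K + s)⁻¹) ∘ G) := by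
    filter_upwards [isOpen_compl_singleton.mem_nhds hxp] with z hz
    have hz' : z ≠ p := hz
    have h4Kz : 4 * K + G z ≠ 0 := by have := hGpos z hz'; positivity
    rw [hψ z hz', Function.comp_apply, theta_eq h4Kz]
  have hΔ : g.dalembertian ψ (φ.symm y) =
      deriv (deriv (fun s : ℝ ↦ 4 * K - 16 * K ^ 2 * (4 * K + s)⁻¹)) (G (φ.symm y)) *
          g.gradSq G (φ.symm y) +
        deriv (fun s : ℝ ↦ 4 * K - 16 * K ^ 2 * (4 * K + s)⁻¹) (G (φ.symm y)) *
          g.dalembertian G (φ.symm y) := by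
    rw [g.dalembertian_congr_of_eventuallyEq hev,
      g.dalembertian_real_comp hG2 (contDiffAt_theta h4K 2)]
    rfl
  have hgrad : g.gradSq G (φ.symm y) = 4 * a ^ 2 / (‖y - φ p‖ ^ 2) ^ 3 := by
    rw [hS0 y hyt (hflat y hyc) G (hGx.mdifferentiableAt (by simp))]
    have hev2 : (G ∘ φ.symm) =ᶠ[𝓝 y] fun z ↦ a / ‖z - φ p‖ ^ 2 := by
      have hopen : IsOpen (Metric.ball (φ p) r \ {φ p}) :=
        Metric.isOpen_ball.sdiff isClosed_singleton
      filter_upwards [hopen.mem_nhds ⟨hy, hy0⟩] with z hz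
      exact hGchart z (Metric.ball_subset_closedBall hz.1) hz.2
    rw [hev2.gradient_eq, norm_gradient_div_norm_sq a hy0]
  have hΔG : g.dalembertian G (φ.symm y) = g.scalarCurvature (φ.symm y) * G (φ.symm y) / 6 := by
    have := hGreen _ hxp
    linarith
  have hn : 0 < ‖y - φ p‖ ^ 2 := by
    have : y - φ p ≠ 0 := sub_ne_zero.2 hy0
    positivity
  rw [hΔ, deriv_deriv_theta h4K, deriv_theta, hΔG, hgrad, hψ _ hxp, hGchart y hyc hy0]
  exact cap_algebra hK ha hn (hR _)

end Cap

end SphereSideClause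

/-- **Registered sub-goal `sphereSideCurvBound` of stub `stub_sphereSideClause`** (helper file of
line `green-blowup-conformal-entropy`, crux stmt-SmoothPoincare4-10871): in the flat gauge at `p`,
for `R_g ≥ 0`, Green data off `p` and `ψ = 4KG/(4K+G)` off `p`, assuming by text the flat-chart
gradient identity (S0), the curvature weight satisfies `ψ⁻³ (R_g ψ − 6 Δ_g ψ) ≥ 12/(aK)` on the
punctured open chart ball (`SphereSideClause.curv_bound`). [folklore] -/
theorem sphereSideCurvBound :
    (∀ (M : Type) [TopologicalSpace M] [T2Space M] [SecondCountableTopology M]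
      [ChartedSpace (EuclideanSpace ℝ (Fin 4)) M] [IsManifold (𝓡 4) ∞ M] [CompactSpace M]
      [T3Space M] [MeasurableSpace M] [BorelSpace M]
      (g : PseudoRiemannianMetric (𝓡 4) ∞ (EuclideanSpace ℝ (Fin 4)) (TangentSpace (𝓡 4) : M → Type _))
      (p : M) (y : EuclideanSpace ℝ (Fin 4)), y ∈ (extChartAt (𝓡 4) p).target →
      (∀ X W : EuclideanSpace ℝ (Fin 4),
        g.val ((extChartAt (𝓡 4) p).symm y)
          (mfderiv 𝓘(ℝ, EuclideanSpace ℝ (Fin 4)) (𝓡 4) (extChartAt (𝓡 4) p).symm y X)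
          (mfderiv 𝓘(ℝ, EuclideanSpace ℝ (Fin 4)) (𝓡 4) (extChartAt (𝓡 4) p).symm y W) = ⟪X, W⟫) →
      ∀ f : M → ℝ, MDifferentiableAt (𝓡 4) 𝓘(ℝ, ℝ) f ((extChartAt (𝓡 4) p).symm y) →
        g.gradSq f ((extChartAt (𝓡 4) p).symm y) = ‖gradient (f ∘ (extChartAt (𝓡 4) p).symm) y‖ ^ 2) →
    ∀ (M : Type) [TopologicalSpace M] [T2Space M] [SecondCountableTopology M]
      [ChartedSpace (EuclideanSpace ℝ (Fin 4)) M] [IsManifold (𝓡 4) ∞ M] [CompactSpace M]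
      [T3Space M] [MeasurableSpace M] [BorelSpace M]
      (g : PseudoRiemannianMetric (𝓡 4) ∞ (EuclideanSpace ℝ (Fin 4)) (TangentSpace (𝓡 4) : M → Type _))
      [g.HasLeviCivita], (∀ x, 0 ≤ g.scalarCurvature x) →
      ∀ (p : M) (G : M → ℝ), ContMDiffOn (𝓡 4) 𝓘(ℝ, ℝ) ∞ G {p}ᶜ → (∀ x, x ≠ p → 0 < G x) →
        (∀ x, x ≠ p → g.scalarCurvature x * G x - 6 * g.dalembertian G x = 0) →
      ∀ (a r : ℝ), 0 < a →
        Metric.closedBall (extChartAt (𝓡 4) p p) r ⊆ (extChartAt (𝓡 4) p).target →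
        (∀ y ∈ Metric.closedBall (extChartAt (𝓡 4) p p) r, ∀ X W : EuclideanSpace ℝ (Fin 4),
          g.val ((extChartAt (𝓡 4) p).symm y)
            (mfderiv 𝓘(ℝ, EuclideanSpace ℝ (Fin 4)) (𝓡 4) (extChartAt (𝓡 4) p).symm y X)
            (mfderiv 𝓘(ℝ, EuclideanSpace ℝ (Fin 4)) (𝓡 4) (extChartAt (𝓡 4) p).symm y W) = ⟪X, W⟫) →
        (∀ y ∈ Metric.closedBall (extChartAt (𝓡 4) p p) r, y ≠ extChartAt (𝓡 4) p p →
          G ((extChartAt (𝓡 4) p).symm y) = a / ‖y - extChartAt (𝓡 4) p p‖ ^ 2) →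
      ∀ (K : ℝ), 0 < K → ∀ (ψ : M → ℝ), (∀ x, x ≠ p → ψ x = 4 * K * G x / (4 * K + G x)) →
      ∀ y ∈ Metric.ball (extChartAt (𝓡 4) p p) r, y ≠ extChartAt (𝓡 4) p p →
        12 / (a * K) ≤ (ψ ((extChartAt (𝓡 4) p).symm y) ^ 3)⁻¹ *
          (g.scalarCurvature ((extChartAt (𝓡 4) p).symm y) * ψ ((extChartAt (𝓡 4) p).symm y) -
            6 * g.dalembertian ψ ((extChartAt (𝓡 4) p).symm y)) := by
  intro h0 M _ _ _ _ _ _ _ _ _ g _ hR p G hGs hGpos hGreen a r ha hball hflat hGchart K hK ψ hψ y hy hy0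
  exact SphereSideClause.curv_bound g (h0 M g p) hR hGs hGpos hGreen ha hball hflat hGchart hK hψ
    hy hy0

end Summit.SmoothPoincare4.SmoothPoincare4.Theorems

end
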